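import Summits.QuantumFields.BalabanUV.T4Continuum.Support.B13StepOfRecordSubstrate
import Summits.QuantumFields.BalabanUV.T4Continuum.Support.B13StepEnvelopeEndMeasOp

/-!
# NE5 ∕ U3 — E9[rec] (THE CAUCHY-ENVELOPE END OF RECORD) AT THE SUBSTRATE's O1 INSTANCE OF RECORD `slotsOfRecord …`

Cell `pub-balaban`, unit `b2b-balaban-t4-ne5-formalise-leaf-03` (NE5 formalisation swarm, LEAF PROVER 03, gen 11; lineage follower of this
lineage's `Support/B13StepEnvelopeEndSub.lean` p216841 ∕ `Support/B13StepEnvelopeEndMeasOp.lean` p217285 on the SUBSTRATE cell's O1 instance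
`Support/SubstrateSlotsOfRecord.lean` p220104 (MAP §O1 O-8), consuming leaf-01-g11's `Support/B13StepOfRecordSubstrate.lean` p221190 §1∕§2 BY
NAME — the E9 twin of its E8 §3).  Summits-side NEW WORK under the LEAN PLACEMENT RULE (cell bookkeeping; 0 def; NOT a Literature module).
HONEST FRAMING: rung (B)+1 of the FINITE-VOLUME T⁴ continuum programme — NOT infinite volume, NOT a mass gap, NOT the Clay problem, and **NOT
A PROOF OF NE5**: every theorem below is an IMPLICATION whose wall binders — W2-op = `ActOpLineAnalyticOn` of the cores OF THE INSTANCE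
(`SubstrateActivities.actOfLetters … (coreLettersOf … L.A)`, read through `↥measOp → OpDatum`; GAPS G-ne5p1-1′∕1″, NOT PRINTED, NOT
discharged), the per-activity norm majorant with decay split and anchored norm ((2.38)∕(1.26) KIND), W1 in row NE2's entry currency, W4, the
one-run slice budgets (W3 KIND), the quoted levels L05∕L06 ([Balaban1987RG1] (1.18) p. 263 SHAPE), the numerics, AND the substrate's LETTER
CONDITIONS (format-boundedness of the raw records, measurability of the potential tables, factorisation of `iopA` through the transport) — are
DISPLAYED HYPOTHESES about the substrate's displayed letters `L`, asserted nowhere (c3∕c4∕c6; R34: the instance is the substrate's, this file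
is the SOCKET side applied BY NAME; CLAIM RULE 5: no species is typed here).
HONEST DEPENDENCY (cell line, verbatim): continuum YM on T⁴ ⇐ BetaPertH ∧ nine spine estimates (0/9 proved); BetaPertH ⇐ (D1) ∧ (D4) ∧
CAP+tail; G-an2-4 gates asym, D1 and NE2/3/4.

WHAT IS PROVED (kernel; `[folklore]`; each a ONE-LINE application of the parent BY NAME):
* §1 **`ne5_of_substrate_restrict_envelope_actNormDecay`** — p216841's `ne5_of_record_restrict_envelope_actNormDecay` AT
  `S₀ := slotsOfRecord D ι c a s P 𝒵 dom Jc V mI L`, `M := measOp T κ ι′ Ω 𝒴` (κ = the O-3′ RIDER index): `hMA`∕`hMB` from p221190 §1's six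
  letter conditions, `hT` from p221190 §2's factorisation datum `(iopAt, hiopA)`, margins ∕ age damping read off `L`; every other binder
  VERBATIM; conclusion LITERALLY `NE5 (B13StepOfRecord.outA (slotsOfRecord …) E₀ cB) (B13StepOfRecord.outB (slotsOfRecord …) E₀ cB) W κ θ′ C₅`
  with E9[rec]'s `C₅` VERBATIM (p214842's).
* §2 **`exists_ne5_of_substrate_restrict_envelope_actNormDecay`** — the same with the arithmetic letters `ρ₀, k₀, B` ELIMINATED (p216841's
  `exists_…`: `0 < θ < 1` and the two strict size inequalities).
* §3 **`exists_ne5_of_substrate_measOp_envelope_readAt`** — p217285's most-reduced face AT the instance READ AT THE TRANSPORTED BACKGROUND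
  (`readAtSlots (slotsOfRecord …) ι`): NO reading datum at all (the reading is BY CONSTRUCTION on `readAtSlots`, sidestepping F-ne5leaf01g11-1),
  its eight measurability ∕ format binders ↦ the six letter conditions (the formats' potential weights are `x`-free by construction).
CENSUS vs p216841 (binders, by name): MINUS = [hMA, hMB, hT]; PLUS = [hbdA, hmQA, hmRA, hbdB, hmQB, hmRB, iopAt, hiopA]; rest IDENTICAL
(specialised).  The η-uniform E9 faces (p218872 ∕ p218923) bind `S₀` INSIDE their `∃ C₅` and apply at the instance by specialisation —
nothing to file.  0 sorry; axioms ⊆ {propext, Classical.choice, Quot.sound}.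
-/

noncomputable section

open scoped BigOperators
open Metric Set MeasureTheory

namespace Summit.QuantumFields.BalabanUV.T4Continuum.B13StepEnvelopeEndSubstrate

open Literature.MathematicalPhysics.QuantumFieldTheory.Balaban1983to89
open Literature.MathematicalPhysics.QuantumFieldTheory.Balaban1983to89.T4OutputRate (DecayBound NE5)
open Literature.MathematicalPhysics.QuantumFieldTheory.Balaban1983to89.T4InputCauchyRateSpecies (ballClass)
open Literature.MathematicalPhysics.QuantumFieldTheory.Balaban1983to89.B5Prop11Plancherel (Tor)
open Summit.QuantumFields.BalabanUV.T4Continuum.B13Carriers (TwoRuns)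
open Summit.QuantumFields.BalabanUV.T4Continuum.B13OpDatum (OpDatum Species FormatBounded B13Weights)
open Summit.QuantumFields.BalabanUV.T4Continuum.B13OpDatumJunctions (opOf RawBounded WeightedEntrywiseRate)
open Summit.QuantumFields.BalabanUV.T4Continuum.B13OpMeasurable (measOp)
open Summit.QuantumFields.BalabanUV.T4Continuum.B13HistMeasurable (MeasPotFrame B13HistM)
open Summit.QuantumFields.BalabanUV.T4Continuum.B13StepTermLabels (TermIdx InnerLabel)
open Summit.QuantumFields.BalabanUV.T4Continuum.B13StepTermFamily (ActData ActExpLinearOn)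
open Summit.QuantumFields.BalabanUV.T4Continuum.B13StepTermSocket (labelsIndexing)
open Summit.QuantumFields.BalabanUV.T4Continuum.B13InnerData (Bnd b13InnerData)
open Summit.QuantumFields.BalabanUV.T4Continuum.UrsellTreeSum (ind)
open Summit.QuantumFields.BalabanUV.T4Continuum.UrsellTermBudget (actSum)
open Summit.QuantumFields.BalabanUV.T4Continuum.B13DomainGeometryTR (SCube footprint domainGeometry)
open Summit.QuantumFields.BalabanUV.T4Continuum.B13Base (selfCtr)
open Summit.QuantumFields.BalabanUV.T4Continuum.B13StepOfRecord (Slots assembly step)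
open Summit.QuantumFields.BalabanUV.T4Continuum.B13StepOfRecordSub (assemblyOn restrict)
open Summit.QuantumFields.BalabanUV.T4Continuum.B13StepOfRecordReadAt (readAtSlots)
open Summit.QuantumFields.BalabanUV.T4Continuum.B13TermOpEnvelope (ActOpLineAnalyticOn)
open Summit.QuantumFields.BalabanUV.T4Continuum.B13StepEnvelopeEndSub (ne5_of_record_restrict_envelope_actNormDecay
  exists_ne5_of_record_restrict_envelope_actNormDecay)
open Summit.QuantumFields.BalabanUV.T4Continuum.B13StepEnvelopeEndMeasOp (exists_ne5_of_record_measOp_envelope_readAt)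
open Summit.QuantumFields.BalabanUV.T4Continuum.B13StepOfRecordSubstrate (opA_mem_measOp_slotsOfRecord opB_mem_measOp_slotsOfRecord
  transportReads_slotsOfRecord_of_factor)
open Summit.QuantumFields.BalabanUV.T4Continuum.SubstrateBackgroundTransporters (unitMod)
open Summit.QuantumFields.BalabanUV.T4Continuum.SubstrateTwoRunsDriven (DrivenRuns)
open Summit.QuantumFields.BalabanUV.T4Continuum.SubstrateRawSpecies (rawAOfRecord rawBOfRecord)
open Summit.QuantumFields.BalabanUV.T4Continuum.SubstrateSlotsOfRecord (SpeciesRec SlotLetters slotsOfRecord)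

variable {G : Type} [GaugeGroup G] (D : DrivenRuns G)
variable {o : Type} [Fintype o] [DecidableEq o] (ι : G →* Matrix o o ℂ) (c : ℂ) (a : ℝ) (s : ℕ → ℂ)
variable {T ι' S Ω 𝒴 : Type} [MeasurableSpace Ω] (P : MeasPotFrame D.carriers) {IOp : Type*}
  (𝒵 : D.carriers.Dom → InnerLabel D.carriers.Dom (Bnd D.toTwoRuns) → Type) [∀ Z j, Fintype (𝒵 Z j)] (dom : ∀ Z j, 𝒵 Z j → D.carriers.Dom)
  (Jc : D.carriers.Dom → InnerLabel D.carriers.Dom (Bnd D.toTwoRuns) → Type) [∀ Z j, Fintype (Jc Z j)]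
  (V : D.carriers.Dom → InnerLabel D.carriers.Dom (Bnd D.toTwoRuns) → Type) [∀ Z j, NormedAddCommGroup (V Z j)]
  [∀ Z j, InnerProductSpace ℝ (V Z j)] [∀ Z j, MeasurableSpace (V Z j)] [∀ Z j, BorelSpace (V Z j)] [∀ Z j, FiniteDimensional ℝ (V Z j)]
  (mI : D.carriers.Dom → InnerLabel D.carriers.Dom (Bnd D.toTwoRuns) → Type) [∀ Z j, Fintype (mI Z j)] [∀ Z j, DecidableEq (mI Z j)]
variable (L : SlotLetters D (o := o) (T := T) (ι' := ι') (S := S) (Ω := Ω) (𝒴 := 𝒴) P (IOp := IOp) 𝒵 dom Jc V mI)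
variable {Ω' : Type*} [MeasurableSpace Ω'] (E₀ cB : ℝ)

/-! ## §1 E9[rec] AT THE SUBSTRATE's SLOTS OF RECORD on the measurable operator carrier -/

/-- [folklore] **E9[rec] (CAUCHY-ENVELOPE END OF RECORD) AT THE SUBSTRATE's O1 INSTANCE** — p216841's
`ne5_of_record_restrict_envelope_actNormDecay` at `S₀ := slotsOfRecord D ι c a s P 𝒵 dom Jc V mI L`, `M := measOp`: the membership side
conditions from p221190 §1's six LETTER conditions, the L01 reading from p221190 §2's factorisation datum `(iopAt, hiopA)`, margins and age
damping read off the letters (`L.rOp`, `L.rHist`, `L.ins.ω`); EVERY OTHER BINDER of p216841 VERBATIM at the instance (the per-activity norm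
majorant, **`ActOpLineAnalyticOn`** and `ActExpLinearOn` now about the cores OF THE INSTANCE read through `↥measOp → OpDatum`); conclusion
LITERALLY `NE5 (B13StepOfRecord.outA (slotsOfRecord …) E₀ cB) (B13StepOfRecord.outB (slotsOfRecord …) E₀ cB) W κ θ′ C₅` with E9[rec]'s `C₅`
VERBATIM.  NOT a proof of NE5; nothing of the substrate's letters is asserted. -/
theorem ne5_of_substrate_restrict_envelope_actNormDecay {W : Set (ℕ → ℝ)} {ROp RHist : ℕ → ℝ}
    {A A' : ℕ → (ℕ → ℝ) → D.toTwoRuns.carriers.BgB → D.toTwoRuns.carriers.Dom → InnerLabel D.toTwoRuns.carriers.Dom (Bnd D.toTwoRuns) → ℝ}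
    {Dt : ActData D.toTwoRuns.carriers.Dom (InnerLabel D.toTwoRuns.carriers.Dom (Bnd D.toTwoRuns)) (measOp T ((Tor (unitMod (D.F.P D.K)) × Fin (D.F.P D.K).d) × o) ι' Ω 𝒴) (B13HistM P) Ω'}
    {κ Φ' EA₀ E₁ cA c₁ r₀ δ' θ θ' ρ₀ B : ℝ} {k₀ : ℕ}
    -- leaf-01-g11's six LETTER conditions (replace `hMA` ∕ `hMB`; p221190 §1)
    (hbdA : ∀ (g : ℕ → ℝ) (U : D.carriers.BgA) (k : ℕ),
      FormatBounded (L.W k).format (rawAOfRecord ι D c a s L.ΓA L.dkA L.gcA L.pQA L.pRA g U k).kernel)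
    (hmQA : ∀ (r : ℝ) (U : GaugeField (D.F.P D.K) 0 G) (k : ℕ) (Y : 𝒴) (b b' : ((Tor (unitMod (D.F.P D.K)) × Fin (D.F.P D.K).d) × o)),
        Measurable fun x : Ω => L.pQA r U k x Y b b')
    (hmRA : ∀ (r : ℝ) (U : GaugeField (D.F.P D.K) 0 G) (k : ℕ) (Y : 𝒴), Measurable fun x : Ω => L.pRA r U k x Y)
    (hbdB : ∀ (g : ℕ → ℝ) (U : D.carriers.BgB) (k : ℕ),
      FormatBounded (L.W k).format (rawBOfRecord ι D c a s L.ΓB L.dkB L.gcB L.pQB L.pRB g U k).kernel)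
    (hmQB : ∀ (r : ℝ) (U : GaugeField (D.F.P (D.K + 1)) 0 G) (k : ℕ) (Y : 𝒴) (b b' : ((Tor (unitMod (D.F.P D.K)) × Fin (D.F.P D.K).d) × o)),
        Measurable fun x : Ω => L.pQB r U k x Y b b')
    (hmRB : ∀ (r : ℝ) (U : GaugeField (D.F.P (D.K + 1)) 0 G) (k : ℕ) (Y : 𝒴), Measurable fun x : Ω => L.pRB r U k x Y)
    -- leaf-01-g11's factorisation datum (replaces the L01 reading `hT`; p221190 §2)
    (iopAt : ℝ → D.carriers.BgA → ℕ → IOp)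
    (hiopA : ∀ (r : ℝ) (U : D.carriers.BgB) (k : ℕ), L.ins.iopA r U k = iopAt r (D.carriers.transport U) k)
    -- E9[rec]'s binders VERBATIM at the instance
    (hbB : (assembly (slotsOfRecord D ι c a s P 𝒵 dom Jc V mI L)).SliceBudgetB W κ cB)
    (hbA : (slotsOfRecord D ι c a s P 𝒵 dom Jc V mI L).D.SliceBudget (step (slotsOfRecord D ι c a s P 𝒵 dom Jc V mI L) E₀ cB) W κ cA)
    (hdA : DecayBound (B13StepOfRecord.outA (slotsOfRecord D ι c a s P 𝒵 dom Jc V mI L) E₀ cB) W EA₀ κ)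
    (hdB : DecayBound (B13StepOfRecord.outB (slotsOfRecord D ι c a s P 𝒵 dom Jc V mI L) E₀ cB) W E₀ κ)
    (hRA : RawBounded (slotsOfRecord D ι c a s P 𝒵 dom Jc V mI L).F (assembly (slotsOfRecord D ι c a s P 𝒵 dom Jc V mI L)).rawAt W)
    (hRB : RawBounded (slotsOfRecord D ι c a s P 𝒵 dom Jc V mI L).F (slotsOfRecord D ι c a s P 𝒵 dom Jc V mI L).rawB W)
    (hwer : WeightedEntrywiseRate (slotsOfRecord D ι c a s P 𝒵 dom Jc V mI L).F (assembly (slotsOfRecord D ι c a s P 𝒵 dom Jc V mI L)).rawAt (slotsOfRecord D ι c a s P 𝒵 dom Jc V mI L).rawB W c₁ fun k => θ ^ k)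
    (hfl : ∀ k, r₀ ≤ L.rOp k)
    (hins : (step (slotsOfRecord D ι c a s P 𝒵 dom Jc V mI L) E₀ cB).InsertionRate W κ E₀ δ' θ)
    (hOp : ∀ k, L.rOp k ≤ ROp k) (hHist : ∀ k, (assembly (slotsOfRecord D ι c a s P 𝒵 dom Jc V mI L)).bHist E₀ cB k + L.rHist k ≤ RHist k)
    (hA : ∀ k, ∀ g ∈ W, ∀ (U : D.toTwoRuns.carriers.BgB) (q : (measOp T ((Tor (unitMod (D.F.P D.K)) × Fin (D.F.P D.K).d) × o) ι' Ω 𝒴) × B13HistM P),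
      q ∈ (ballClass (selfCtr (assemblyOn (restrict (slotsOfRecord D ι c a s P 𝒵 dom Jc V mI L) (measOp T ((Tor (unitMod (D.F.P D.K)) × Fin (D.F.P D.K).d) × o) ι' Ω 𝒴)
          (opA_mem_measOp_slotsOfRecord D ι c a s P 𝒵 dom Jc V mI L hbdA hmQA hmRA)
          (opB_mem_measOp_slotsOfRecord D ι c a s P 𝒵 dom Jc V mI L hbdB hmQB hmRB))).raw
        (assemblyOn (restrict (slotsOfRecord D ι c a s P 𝒵 dom Jc V mI L) (measOp T ((Tor (unitMod (D.F.P D.K)) × Fin (D.F.P D.K).d) × o) ι' Ω 𝒴)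
          (opA_mem_measOp_slotsOfRecord D ι c a s P 𝒵 dom Jc V mI L hbdA hmQA hmRA)
          (opB_mem_measOp_slotsOfRecord D ι c a s P 𝒵 dom Jc V mI L hbdB hmQB hmRB))).histRef) ROp RHist) k g U →
        ∀ X : D.toTwoRuns.carriers.Dom, D.toTwoRuns.carriers.scale X = k → ∀ i : TermIdx D.toTwoRuns.carriers.Dom (Bnd D.toTwoRuns),
          (labelsIndexing (domainGeometry D.toTwoRuns) (b13InnerData D.toTwoRuns)).Rel k i X → ∀ m,
            ‖(slotsOfRecord D ι c a s P 𝒵 dom Jc V mI L).act ((labelsIndexing (domainGeometry D.toTwoRuns) (b13InnerData D.toTwoRuns)).poly i m) ((labelsIndexing (domainGeometry D.toTwoRuns) (b13InnerData D.toTwoRuns)).lab i m) (q.1 : OpDatum (SpeciesRec D o T ι' Ω 𝒴)) q.2‖ ≤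
              A k g U ((labelsIndexing (domainGeometry D.toTwoRuns) (b13InnerData D.toTwoRuns)).poly i m) ((labelsIndexing (domainGeometry D.toTwoRuns) (b13InnerData D.toTwoRuns)).lab i m))
    (hA0 : ∀ k g U Z ℓ, 0 ≤ A k g U Z ℓ) (hA0' : ∀ k g U Z ℓ, 0 ≤ A' k g U Z ℓ) (hκ : 0 ≤ κ)
    (hdec : ∀ k g U Z ℓ, A k g U Z ℓ ≤ A' k g U Z ℓ * Real.exp (-(κ * (D.toTwoRuns.carriers.d Z + 5))))
    (hΦ0 : 0 ≤ Φ') (hΦsmall : 36 * Φ' < 1)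
    (hΦ : ∀ k, ∀ g ∈ W, ∀ (U : D.toTwoRuns.carriers.BgB) (q : SCube D.toTwoRuns),
      ∑ Z ∈ D.toTwoRuns.domAt k, ind (q ∈ footprint Z) * actSum (b13InnerData D.toTwoRuns) (A' k g U) k Z *
        Real.exp ((footprint Z).card) ≤ Φ')
    (hact : ActOpLineAnalyticOn (labelsIndexing (domainGeometry D.toTwoRuns) (b13InnerData D.toTwoRuns)) (restrict (slotsOfRecord D ι c a s P 𝒵 dom Jc V mI L) (measOp T ((Tor (unitMod (D.F.P D.K)) × Fin (D.F.P D.K).d) × o) ι' Ω 𝒴)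
          (opA_mem_measOp_slotsOfRecord D ι c a s P 𝒵 dom Jc V mI L hbdA hmQA hmRA)
          (opB_mem_measOp_slotsOfRecord D ι c a s P 𝒵 dom Jc V mI L hbdB hmQB hmRB)).act
      (ballClass (selfCtr (assemblyOn (restrict (slotsOfRecord D ι c a s P 𝒵 dom Jc V mI L) (measOp T ((Tor (unitMod (D.F.P D.K)) × Fin (D.F.P D.K).d) × o) ι' Ω 𝒴)
          (opA_mem_measOp_slotsOfRecord D ι c a s P 𝒵 dom Jc V mI L hbdA hmQA hmRA)
          (opB_mem_measOp_slotsOfRecord D ι c a s P 𝒵 dom Jc V mI L hbdB hmQB hmRB))).raw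
        (assemblyOn (restrict (slotsOfRecord D ι c a s P 𝒵 dom Jc V mI L) (measOp T ((Tor (unitMod (D.F.P D.K)) × Fin (D.F.P D.K).d) × o) ι' Ω 𝒴)
          (opA_mem_measOp_slotsOfRecord D ι c a s P 𝒵 dom Jc V mI L hbdA hmQA hmRA)
          (opB_mem_measOp_slotsOfRecord D ι c a s P 𝒵 dom Jc V mI L hbdB hmQB hmRB))).histRef) ROp RHist) W)
    (hexp : ActExpLinearOn (labelsIndexing (domainGeometry D.toTwoRuns) (b13InnerData D.toTwoRuns)) (restrict (slotsOfRecord D ι c a s P 𝒵 dom Jc V mI L) (measOp T ((Tor (unitMod (D.F.P D.K)) × Fin (D.F.P D.K).d) × o) ι' Ω 𝒴)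
          (opA_mem_measOp_slotsOfRecord D ι c a s P 𝒵 dom Jc V mI L hbdA hmQA hmRA)
          (opB_mem_measOp_slotsOfRecord D ι c a s P 𝒵 dom Jc V mI L hbdB hmQB hmRB)).act Dt
      (ballClass (selfCtr (assemblyOn (restrict (slotsOfRecord D ι c a s P 𝒵 dom Jc V mI L) (measOp T ((Tor (unitMod (D.F.P D.K)) × Fin (D.F.P D.K).d) × o) ι' Ω 𝒴)
          (opA_mem_measOp_slotsOfRecord D ι c a s P 𝒵 dom Jc V mI L hbdA hmQA hmRA)
          (opB_mem_measOp_slotsOfRecord D ι c a s P 𝒵 dom Jc V mI L hbdB hmQB hmRB))).raw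
        (assemblyOn (restrict (slotsOfRecord D ι c a s P 𝒵 dom Jc V mI L) (measOp T ((Tor (unitMod (D.F.P D.K)) × Fin (D.F.P D.K).d) × o) ι' Ω 𝒴)
          (opA_mem_measOp_slotsOfRecord D ι c a s P 𝒵 dom Jc V mI L hbdA hmQA hmRA)
          (opB_mem_measOp_slotsOfRecord D ι c a s P 𝒵 dom Jc V mI L hbdB hmQB hmRB))).histRef) ROp RHist) W)
    (hE₀ : 0 ≤ E₀) (hE₁ : 0 < E₁) (hcA : 0 ≤ cA) (hcB : 0 ≤ cB) (hc₁ : 0 ≤ c₁) (hr₀ : 0 < r₀) (hδ' : 0 ≤ δ')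
    (hθ : 0 ≤ θ) (hθθ' : θ ≤ θ') (hθ'1 : θ' ≤ 1) (hω : 0 < L.ins.ω) (hω1 : L.ins.ω < 1) (hρ₀ : ρ₀ < 1)
    (hnear : (c₁ / r₀ + δ') * θ ^ k₀ + cA * (EA₀ + E₀) / (1 - L.ins.ω) ≤ ρ₀) (hB : 0 ≤ B)
    (hfirst : ∀ k < k₀, EA₀ + E₀ ≤ B * θ ^ k) (hsmall : L.ins.ω + Φ' / (1 - 36 * Φ') / (1 - ρ₀) * cA < θ') :
    NE5 (B13StepOfRecord.outA (slotsOfRecord D ι c a s P 𝒵 dom Jc V mI L) E₀ cB) (B13StepOfRecord.outB (slotsOfRecord D ι c a s P 𝒵 dom Jc V mI L) E₀ cB) W κ θ'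
      ((Φ' / (1 - 36 * Φ') / (1 - ρ₀) * (c₁ / r₀) + Φ' / (1 - 36 * Φ') / (1 - ρ₀) * δ' + B) * (θ' - L.ins.ω) /
        (θ' - (L.ins.ω + Φ' / (1 - 36 * Φ') / (1 - ρ₀) * cA))) :=
  ne5_of_record_restrict_envelope_actNormDecay (slotsOfRecord D ι c a s P 𝒵 dom Jc V mI L) (measOp T ((Tor (unitMod (D.F.P D.K)) × Fin (D.F.P D.K).d) × o) ι' Ω 𝒴)
    (opA_mem_measOp_slotsOfRecord D ι c a s P 𝒵 dom Jc V mI L hbdA hmQA hmRA)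
    (opB_mem_measOp_slotsOfRecord D ι c a s P 𝒵 dom Jc V mI L hbdB hmQB hmRB) E₀ cB
    (transportReads_slotsOfRecord_of_factor D ι c a s P 𝒵 dom Jc V mI L iopAt hiopA W) hbB hbA hdA hdB hRA hRB hwer hfl hins hOp hHist hA
    hA0 hA0' hκ hdec hΦ0 hΦsmall hΦ hact hexp hE₀ hE₁ hcA hcB hc₁ hr₀ hδ' hθ hθθ' hθ'1 hω hω1 hρ₀ hnear hB hfirst hsmall

/-! ## §2 The same with the arithmetic letters eliminated -/

/-- [folklore] **E9[rec] AT THE SUBSTRATE's O1 INSTANCE, ARITHMETIC LETTERS ELIMINATED** — p216841's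
`exists_ne5_of_record_restrict_envelope_actNormDecay` at the instance: §1's binders with `ρ₀, k₀, B` REPLACED by `0 < θ < 1` and the two
strict size inequalities (sharp, leaf-10's `reach_elim_iff`); `∃ C₅, NE5 (B13StepOfRecord.outA (slotsOfRecord …) E₀ cB)
(B13StepOfRecord.outB (slotsOfRecord …) E₀ cB) W κ θ′ C₅`.  NOT a proof of NE5. -/
theorem exists_ne5_of_substrate_restrict_envelope_actNormDecay {W : Set (ℕ → ℝ)} {ROp RHist : ℕ → ℝ}
    {A A' : ℕ → (ℕ → ℝ) → D.toTwoRuns.carriers.BgB → D.toTwoRuns.carriers.Dom → InnerLabel D.toTwoRuns.carriers.Dom (Bnd D.toTwoRuns) → ℝ}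
    {Dt : ActData D.toTwoRuns.carriers.Dom (InnerLabel D.toTwoRuns.carriers.Dom (Bnd D.toTwoRuns)) (measOp T ((Tor (unitMod (D.F.P D.K)) × Fin (D.F.P D.K).d) × o) ι' Ω 𝒴) (B13HistM P) Ω'}
    {κ Φ' EA₀ cA c₁ r₀ δ' θ θ' : ℝ}
    -- leaf-01-g11's six LETTER conditions (replace `hMA` ∕ `hMB`; p221190 §1)
    (hbdA : ∀ (g : ℕ → ℝ) (U : D.carriers.BgA) (k : ℕ),
      FormatBounded (L.W k).format (rawAOfRecord ι D c a s L.ΓA L.dkA L.gcA L.pQA L.pRA g U k).kernel)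
    (hmQA : ∀ (r : ℝ) (U : GaugeField (D.F.P D.K) 0 G) (k : ℕ) (Y : 𝒴) (b b' : ((Tor (unitMod (D.F.P D.K)) × Fin (D.F.P D.K).d) × o)),
        Measurable fun x : Ω => L.pQA r U k x Y b b')
    (hmRA : ∀ (r : ℝ) (U : GaugeField (D.F.P D.K) 0 G) (k : ℕ) (Y : 𝒴), Measurable fun x : Ω => L.pRA r U k x Y)
    (hbdB : ∀ (g : ℕ → ℝ) (U : D.carriers.BgB) (k : ℕ),
      FormatBounded (L.W k).format (rawBOfRecord ι D c a s L.ΓB L.dkB L.gcB L.pQB L.pRB g U k).kernel)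
    (hmQB : ∀ (r : ℝ) (U : GaugeField (D.F.P (D.K + 1)) 0 G) (k : ℕ) (Y : 𝒴) (b b' : ((Tor (unitMod (D.F.P D.K)) × Fin (D.F.P D.K).d) × o)),
        Measurable fun x : Ω => L.pQB r U k x Y b b')
    (hmRB : ∀ (r : ℝ) (U : GaugeField (D.F.P (D.K + 1)) 0 G) (k : ℕ) (Y : 𝒴), Measurable fun x : Ω => L.pRB r U k x Y)
    -- leaf-01-g11's factorisation datum (replaces the L01 reading `hT`; p221190 §2)
    (iopAt : ℝ → D.carriers.BgA → ℕ → IOp)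
    (hiopA : ∀ (r : ℝ) (U : D.carriers.BgB) (k : ℕ), L.ins.iopA r U k = iopAt r (D.carriers.transport U) k)
    -- E9[rec]'s binders VERBATIM at the instance
    (hbB : (assembly (slotsOfRecord D ι c a s P 𝒵 dom Jc V mI L)).SliceBudgetB W κ cB)
    (hbA : (slotsOfRecord D ι c a s P 𝒵 dom Jc V mI L).D.SliceBudget (step (slotsOfRecord D ι c a s P 𝒵 dom Jc V mI L) E₀ cB) W κ cA)
    (hdA : DecayBound (B13StepOfRecord.outA (slotsOfRecord D ι c a s P 𝒵 dom Jc V mI L) E₀ cB) W EA₀ κ)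
    (hdB : DecayBound (B13StepOfRecord.outB (slotsOfRecord D ι c a s P 𝒵 dom Jc V mI L) E₀ cB) W E₀ κ)
    (hRA : RawBounded (slotsOfRecord D ι c a s P 𝒵 dom Jc V mI L).F (assembly (slotsOfRecord D ι c a s P 𝒵 dom Jc V mI L)).rawAt W)
    (hRB : RawBounded (slotsOfRecord D ι c a s P 𝒵 dom Jc V mI L).F (slotsOfRecord D ι c a s P 𝒵 dom Jc V mI L).rawB W)
    (hwer : WeightedEntrywiseRate (slotsOfRecord D ι c a s P 𝒵 dom Jc V mI L).F (assembly (slotsOfRecord D ι c a s P 𝒵 dom Jc V mI L)).rawAt (slotsOfRecord D ι c a s P 𝒵 dom Jc V mI L).rawB W c₁ fun k => θ ^ k)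
    (hfl : ∀ k, r₀ ≤ L.rOp k)
    (hins : (step (slotsOfRecord D ι c a s P 𝒵 dom Jc V mI L) E₀ cB).InsertionRate W κ E₀ δ' θ)
    (hOp : ∀ k, L.rOp k ≤ ROp k) (hHist : ∀ k, (assembly (slotsOfRecord D ι c a s P 𝒵 dom Jc V mI L)).bHist E₀ cB k + L.rHist k ≤ RHist k)
    (hA : ∀ k, ∀ g ∈ W, ∀ (U : D.toTwoRuns.carriers.BgB) (q : (measOp T ((Tor (unitMod (D.F.P D.K)) × Fin (D.F.P D.K).d) × o) ι' Ω 𝒴) × B13HistM P),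
      q ∈ (ballClass (selfCtr (assemblyOn (restrict (slotsOfRecord D ι c a s P 𝒵 dom Jc V mI L) (measOp T ((Tor (unitMod (D.F.P D.K)) × Fin (D.F.P D.K).d) × o) ι' Ω 𝒴)
          (opA_mem_measOp_slotsOfRecord D ι c a s P 𝒵 dom Jc V mI L hbdA hmQA hmRA)
          (opB_mem_measOp_slotsOfRecord D ι c a s P 𝒵 dom Jc V mI L hbdB hmQB hmRB))).raw
        (assemblyOn (restrict (slotsOfRecord D ι c a s P 𝒵 dom Jc V mI L) (measOp T ((Tor (unitMod (D.F.P D.K)) × Fin (D.F.P D.K).d) × o) ι' Ω 𝒴)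
          (opA_mem_measOp_slotsOfRecord D ι c a s P 𝒵 dom Jc V mI L hbdA hmQA hmRA)
          (opB_mem_measOp_slotsOfRecord D ι c a s P 𝒵 dom Jc V mI L hbdB hmQB hmRB))).histRef) ROp RHist) k g U →
        ∀ X : D.toTwoRuns.carriers.Dom, D.toTwoRuns.carriers.scale X = k → ∀ i : TermIdx D.toTwoRuns.carriers.Dom (Bnd D.toTwoRuns),
          (labelsIndexing (domainGeometry D.toTwoRuns) (b13InnerData D.toTwoRuns)).Rel k i X → ∀ m,
            ‖(slotsOfRecord D ι c a s P 𝒵 dom Jc V mI L).act ((labelsIndexing (domainGeometry D.toTwoRuns) (b13InnerData D.toTwoRuns)).poly i m) ((labelsIndexing (domainGeometry D.toTwoRuns) (b13InnerData D.toTwoRuns)).lab i m) (q.1 : OpDatum (SpeciesRec D o T ι' Ω 𝒴)) q.2‖ ≤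
              A k g U ((labelsIndexing (domainGeometry D.toTwoRuns) (b13InnerData D.toTwoRuns)).poly i m) ((labelsIndexing (domainGeometry D.toTwoRuns) (b13InnerData D.toTwoRuns)).lab i m))
    (hA0 : ∀ k g U Z ℓ, 0 ≤ A k g U Z ℓ) (hA0' : ∀ k g U Z ℓ, 0 ≤ A' k g U Z ℓ) (hκ : 0 ≤ κ)
    (hdec : ∀ k g U Z ℓ, A k g U Z ℓ ≤ A' k g U Z ℓ * Real.exp (-(κ * (D.toTwoRuns.carriers.d Z + 5))))
    (hΦ0 : 0 ≤ Φ') (hΦsmall : 36 * Φ' < 1)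
    (hΦ : ∀ k, ∀ g ∈ W, ∀ (U : D.toTwoRuns.carriers.BgB) (q : SCube D.toTwoRuns),
      ∑ Z ∈ D.toTwoRuns.domAt k, ind (q ∈ footprint Z) * actSum (b13InnerData D.toTwoRuns) (A' k g U) k Z *
        Real.exp ((footprint Z).card) ≤ Φ')
    (hact : ActOpLineAnalyticOn (labelsIndexing (domainGeometry D.toTwoRuns) (b13InnerData D.toTwoRuns)) (restrict (slotsOfRecord D ι c a s P 𝒵 dom Jc V mI L) (measOp T ((Tor (unitMod (D.F.P D.K)) × Fin (D.F.P D.K).d) × o) ι' Ω 𝒴)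
          (opA_mem_measOp_slotsOfRecord D ι c a s P 𝒵 dom Jc V mI L hbdA hmQA hmRA)
          (opB_mem_measOp_slotsOfRecord D ι c a s P 𝒵 dom Jc V mI L hbdB hmQB hmRB)).act
      (ballClass (selfCtr (assemblyOn (restrict (slotsOfRecord D ι c a s P 𝒵 dom Jc V mI L) (measOp T ((Tor (unitMod (D.F.P D.K)) × Fin (D.F.P D.K).d) × o) ι' Ω 𝒴)
          (opA_mem_measOp_slotsOfRecord D ι c a s P 𝒵 dom Jc V mI L hbdA hmQA hmRA)
          (opB_mem_measOp_slotsOfRecord D ι c a s P 𝒵 dom Jc V mI L hbdB hmQB hmRB))).raw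
        (assemblyOn (restrict (slotsOfRecord D ι c a s P 𝒵 dom Jc V mI L) (measOp T ((Tor (unitMod (D.F.P D.K)) × Fin (D.F.P D.K).d) × o) ι' Ω 𝒴)
          (opA_mem_measOp_slotsOfRecord D ι c a s P 𝒵 dom Jc V mI L hbdA hmQA hmRA)
          (opB_mem_measOp_slotsOfRecord D ι c a s P 𝒵 dom Jc V mI L hbdB hmQB hmRB))).histRef) ROp RHist) W)
    (hexp : ActExpLinearOn (labelsIndexing (domainGeometry D.toTwoRuns) (b13InnerData D.toTwoRuns)) (restrict (slotsOfRecord D ι c a s P 𝒵 dom Jc V mI L) (measOp T ((Tor (unitMod (D.F.P D.K)) × Fin (D.F.P D.K).d) × o) ι' Ω 𝒴)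
          (opA_mem_measOp_slotsOfRecord D ι c a s P 𝒵 dom Jc V mI L hbdA hmQA hmRA)
          (opB_mem_measOp_slotsOfRecord D ι c a s P 𝒵 dom Jc V mI L hbdB hmQB hmRB)).act Dt
      (ballClass (selfCtr (assemblyOn (restrict (slotsOfRecord D ι c a s P 𝒵 dom Jc V mI L) (measOp T ((Tor (unitMod (D.F.P D.K)) × Fin (D.F.P D.K).d) × o) ι' Ω 𝒴)
          (opA_mem_measOp_slotsOfRecord D ι c a s P 𝒵 dom Jc V mI L hbdA hmQA hmRA)
          (opB_mem_measOp_slotsOfRecord D ι c a s P 𝒵 dom Jc V mI L hbdB hmQB hmRB))).raw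
        (assemblyOn (restrict (slotsOfRecord D ι c a s P 𝒵 dom Jc V mI L) (measOp T ((Tor (unitMod (D.F.P D.K)) × Fin (D.F.P D.K).d) × o) ι' Ω 𝒴)
          (opA_mem_measOp_slotsOfRecord D ι c a s P 𝒵 dom Jc V mI L hbdA hmQA hmRA)
          (opB_mem_measOp_slotsOfRecord D ι c a s P 𝒵 dom Jc V mI L hbdB hmQB hmRB))).histRef) ROp RHist) W)
    (hE₀ : 0 ≤ E₀) (hcA : 0 ≤ cA) (hcB : 0 ≤ cB) (hc₁ : 0 ≤ c₁) (hr₀ : 0 < r₀) (hδ' : 0 ≤ δ')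
    (hθ0 : 0 < θ) (hθ1 : θ < 1) (hθθ' : θ ≤ θ') (hθ'1 : θ' ≤ 1) (hω : 0 < L.ins.ω) (hω1 : L.ins.ω < 1)
    (hh : cA * (EA₀ + E₀) < 1 - L.ins.ω)
    (hsmall : L.ins.ω + Φ' / (1 - 36 * Φ') * cA * (1 - L.ins.ω) / (1 - L.ins.ω - cA * (EA₀ + E₀)) < θ') :
    ∃ C₅, NE5 (B13StepOfRecord.outA (slotsOfRecord D ι c a s P 𝒵 dom Jc V mI L) E₀ cB) (B13StepOfRecord.outB (slotsOfRecord D ι c a s P 𝒵 dom Jc V mI L) E₀ cB) W κ θ' C₅ :=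
  exists_ne5_of_record_restrict_envelope_actNormDecay (slotsOfRecord D ι c a s P 𝒵 dom Jc V mI L) (measOp T ((Tor (unitMod (D.F.P D.K)) × Fin (D.F.P D.K).d) × o) ι' Ω 𝒴)
    (opA_mem_measOp_slotsOfRecord D ι c a s P 𝒵 dom Jc V mI L hbdA hmQA hmRA)
    (opB_mem_measOp_slotsOfRecord D ι c a s P 𝒵 dom Jc V mI L hbdB hmQB hmRB) E₀ cB
    (transportReads_slotsOfRecord_of_factor D ι c a s P 𝒵 dom Jc V mI L iopAt hiopA W) hbB hbA hdA hdB hRA hRB hwer hfl hins hOp hHist hA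
    hA0 hA0' hκ hdec hΦ0 hΦsmall hΦ hact hexp hE₀ hcA hcB hc₁ hr₀ hδ' hθ0 hθ1 hθθ' hθ'1 hω hω1 hh hsmall

/-! ## §3 The most-reduced face: the instance READ AT THE TRANSPORTED BACKGROUND — no reading datum -/

/-- [folklore] **E9[rec] AT THE SUBSTRATE's O1 INSTANCE READ AT THE TRANSPORTED BACKGROUND** — p217285's
`exists_ne5_of_record_measOp_envelope_readAt` at `S₀ := slotsOfRecord …`: for ANY run-A insertion-operator table `ι` on run A's OWN backgrounds,
the slot package `readAtSlots (slotsOfRecord …) ι` (insertion operators of run A read at `D.carriers.transport U` BY CONSTRUCTION — so the L01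
reading needs NO datum, independently of how the substrate's letter `iopA` is typed) satisfies
`∃ C₅, NE5 (outA (readAtSlots (slotsOfRecord …) ι) E₀ cB) (outB (readAtSlots (slotsOfRecord …) ι) E₀ cB) W κ θ′ C₅` from: the six LETTER
conditions (p221190 §1; the formats' potential weights are `x`-free by construction), the displayed slice budgets, levels, W1 entry data +
floor, W4, room, the activity norm majorant of the cores of the instance through `↥measOp → OpDatum` with decay split + anchored norm,
**`ActOpLineAnalyticOn`**, `ActExpLinearOn`, signs and the two strict size inequalities.  NOT a proof of NE5. -/
theorem exists_ne5_of_substrate_measOp_envelope_readAt (ιbg : (ℕ → ℝ) → D.carriers.BgA → ℕ → IOp) {W : Set (ℕ → ℝ)}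
    {ROp RHist : ℕ → ℝ}
    {A A' : ℕ → (ℕ → ℝ) → D.toTwoRuns.carriers.BgB → D.toTwoRuns.carriers.Dom → InnerLabel D.toTwoRuns.carriers.Dom (Bnd D.toTwoRuns) → ℝ}
    {Dt : ActData D.toTwoRuns.carriers.Dom (InnerLabel D.toTwoRuns.carriers.Dom (Bnd D.toTwoRuns)) (measOp T ((Tor (unitMod (D.F.P D.K)) × Fin (D.F.P D.K).d) × o) ι' Ω 𝒴) (B13HistM P) Ω'}
    {κ Φ' EA₀ cA c₁ r₀ δ' θ θ' : ℝ}
    -- leaf-01-g11's six LETTER conditions (replace `hMA` ∕ `hMB`; p221190 §1)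
    (hbdA : ∀ (g : ℕ → ℝ) (U : D.carriers.BgA) (k : ℕ),
      FormatBounded (L.W k).format (rawAOfRecord ι D c a s L.ΓA L.dkA L.gcA L.pQA L.pRA g U k).kernel)
    (hmQA : ∀ (r : ℝ) (U : GaugeField (D.F.P D.K) 0 G) (k : ℕ) (Y : 𝒴) (b b' : ((Tor (unitMod (D.F.P D.K)) × Fin (D.F.P D.K).d) × o)),
        Measurable fun x : Ω => L.pQA r U k x Y b b')
    (hmRA : ∀ (r : ℝ) (U : GaugeField (D.F.P D.K) 0 G) (k : ℕ) (Y : 𝒴), Measurable fun x : Ω => L.pRA r U k x Y)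
    (hbdB : ∀ (g : ℕ → ℝ) (U : D.carriers.BgB) (k : ℕ),
      FormatBounded (L.W k).format (rawBOfRecord ι D c a s L.ΓB L.dkB L.gcB L.pQB L.pRB g U k).kernel)
    (hmQB : ∀ (r : ℝ) (U : GaugeField (D.F.P (D.K + 1)) 0 G) (k : ℕ) (Y : 𝒴) (b b' : ((Tor (unitMod (D.F.P D.K)) × Fin (D.F.P D.K).d) × o)),
        Measurable fun x : Ω => L.pQB r U k x Y b b')
    (hmRB : ∀ (r : ℝ) (U : GaugeField (D.F.P (D.K + 1)) 0 G) (k : ℕ) (Y : 𝒴), Measurable fun x : Ω => L.pRB r U k x Y)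
    -- E9[rec]'s binders VERBATIM at the instance
    (hbB : (assembly (readAtSlots (slotsOfRecord D ι c a s P 𝒵 dom Jc V mI L) ιbg)).SliceBudgetB W κ cB)
    (hbA : (readAtSlots (slotsOfRecord D ι c a s P 𝒵 dom Jc V mI L) ιbg).D.SliceBudget (step (readAtSlots (slotsOfRecord D ι c a s P 𝒵 dom Jc V mI L) ιbg) E₀ cB) W κ cA)
    (hdA : DecayBound (B13StepOfRecord.outA (readAtSlots (slotsOfRecord D ι c a s P 𝒵 dom Jc V mI L) ιbg) E₀ cB) W EA₀ κ)
    (hdB : DecayBound (B13StepOfRecord.outB (readAtSlots (slotsOfRecord D ι c a s P 𝒵 dom Jc V mI L) ιbg) E₀ cB) W E₀ κ)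
    (hRA : RawBounded (slotsOfRecord D ι c a s P 𝒵 dom Jc V mI L).F (assembly (slotsOfRecord D ι c a s P 𝒵 dom Jc V mI L)).rawAt W)
    (hRB : RawBounded (slotsOfRecord D ι c a s P 𝒵 dom Jc V mI L).F (slotsOfRecord D ι c a s P 𝒵 dom Jc V mI L).rawB W)
    (hwer : WeightedEntrywiseRate (slotsOfRecord D ι c a s P 𝒵 dom Jc V mI L).F (assembly (slotsOfRecord D ι c a s P 𝒵 dom Jc V mI L)).rawAt (slotsOfRecord D ι c a s P 𝒵 dom Jc V mI L).rawB W c₁ fun k => θ ^ k)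
    (hfl : ∀ k, r₀ ≤ L.rOp k)
    (hins : (step (readAtSlots (slotsOfRecord D ι c a s P 𝒵 dom Jc V mI L) ιbg) E₀ cB).InsertionRate W κ E₀ δ' θ)
    (hOp : ∀ k, L.rOp k ≤ ROp k) (hHist : ∀ k, (assembly (slotsOfRecord D ι c a s P 𝒵 dom Jc V mI L)).bHist E₀ cB k + L.rHist k ≤ RHist k)
    (hA : ∀ k, ∀ g ∈ W, ∀ (U : D.toTwoRuns.carriers.BgB) (q : (measOp T ((Tor (unitMod (D.F.P D.K)) × Fin (D.F.P D.K).d) × o) ι' Ω 𝒴) × B13HistM P),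
      q ∈ (ballClass (selfCtr (assemblyOn (restrict (readAtSlots (slotsOfRecord D ι c a s P 𝒵 dom Jc V mI L) ιbg) (measOp T ((Tor (unitMod (D.F.P D.K)) × Fin (D.F.P D.K).d) × o) ι' Ω 𝒴)
          (opA_mem_measOp_slotsOfRecord D ι c a s P 𝒵 dom Jc V mI L hbdA hmQA hmRA)
          (opB_mem_measOp_slotsOfRecord D ι c a s P 𝒵 dom Jc V mI L hbdB hmQB hmRB))).raw
        (assemblyOn (restrict (readAtSlots (slotsOfRecord D ι c a s P 𝒵 dom Jc V mI L) ιbg) (measOp T ((Tor (unitMod (D.F.P D.K)) × Fin (D.F.P D.K).d) × o) ι' Ω 𝒴)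
          (opA_mem_measOp_slotsOfRecord D ι c a s P 𝒵 dom Jc V mI L hbdA hmQA hmRA)
          (opB_mem_measOp_slotsOfRecord D ι c a s P 𝒵 dom Jc V mI L hbdB hmQB hmRB))).histRef) ROp RHist) k g U →
        ∀ X : D.toTwoRuns.carriers.Dom, D.toTwoRuns.carriers.scale X = k → ∀ i : TermIdx D.toTwoRuns.carriers.Dom (Bnd D.toTwoRuns),
          (labelsIndexing (domainGeometry D.toTwoRuns) (b13InnerData D.toTwoRuns)).Rel k i X → ∀ m,
            ‖(slotsOfRecord D ι c a s P 𝒵 dom Jc V mI L).act ((labelsIndexing (domainGeometry D.toTwoRuns) (b13InnerData D.toTwoRuns)).poly i m) ((labelsIndexing (domainGeometry D.toTwoRuns) (b13InnerData D.toTwoRuns)).lab i m) (q.1 : OpDatum (SpeciesRec D o T ι' Ω 𝒴)) q.2‖ ≤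
              A k g U ((labelsIndexing (domainGeometry D.toTwoRuns) (b13InnerData D.toTwoRuns)).poly i m) ((labelsIndexing (domainGeometry D.toTwoRuns) (b13InnerData D.toTwoRuns)).lab i m))
    (hA0 : ∀ k g U Z ℓ, 0 ≤ A k g U Z ℓ) (hA0' : ∀ k g U Z ℓ, 0 ≤ A' k g U Z ℓ) (hκ : 0 ≤ κ)
    (hdec : ∀ k g U Z ℓ, A k g U Z ℓ ≤ A' k g U Z ℓ * Real.exp (-(κ * (D.toTwoRuns.carriers.d Z + 5))))
    (hΦ0 : 0 ≤ Φ') (hΦsmall : 36 * Φ' < 1)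
    (hΦ : ∀ k, ∀ g ∈ W, ∀ (U : D.toTwoRuns.carriers.BgB) (q : SCube D.toTwoRuns),
      ∑ Z ∈ D.toTwoRuns.domAt k, ind (q ∈ footprint Z) * actSum (b13InnerData D.toTwoRuns) (A' k g U) k Z *
        Real.exp ((footprint Z).card) ≤ Φ')
    (hact : ActOpLineAnalyticOn (labelsIndexing (domainGeometry D.toTwoRuns) (b13InnerData D.toTwoRuns)) (restrict (readAtSlots (slotsOfRecord D ι c a s P 𝒵 dom Jc V mI L) ιbg) (measOp T ((Tor (unitMod (D.F.P D.K)) × Fin (D.F.P D.K).d) × o) ι' Ω 𝒴)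
          (opA_mem_measOp_slotsOfRecord D ι c a s P 𝒵 dom Jc V mI L hbdA hmQA hmRA)
          (opB_mem_measOp_slotsOfRecord D ι c a s P 𝒵 dom Jc V mI L hbdB hmQB hmRB)).act
      (ballClass (selfCtr (assemblyOn (restrict (readAtSlots (slotsOfRecord D ι c a s P 𝒵 dom Jc V mI L) ιbg) (measOp T ((Tor (unitMod (D.F.P D.K)) × Fin (D.F.P D.K).d) × o) ι' Ω 𝒴)
          (opA_mem_measOp_slotsOfRecord D ι c a s P 𝒵 dom Jc V mI L hbdA hmQA hmRA)
          (opB_mem_measOp_slotsOfRecord D ι c a s P 𝒵 dom Jc V mI L hbdB hmQB hmRB))).raw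
        (assemblyOn (restrict (readAtSlots (slotsOfRecord D ι c a s P 𝒵 dom Jc V mI L) ιbg) (measOp T ((Tor (unitMod (D.F.P D.K)) × Fin (D.F.P D.K).d) × o) ι' Ω 𝒴)
          (opA_mem_measOp_slotsOfRecord D ι c a s P 𝒵 dom Jc V mI L hbdA hmQA hmRA)
          (opB_mem_measOp_slotsOfRecord D ι c a s P 𝒵 dom Jc V mI L hbdB hmQB hmRB))).histRef) ROp RHist) W)
    (hexp : ActExpLinearOn (labelsIndexing (domainGeometry D.toTwoRuns) (b13InnerData D.toTwoRuns)) (restrict (readAtSlots (slotsOfRecord D ι c a s P 𝒵 dom Jc V mI L) ιbg) (measOp T ((Tor (unitMod (D.F.P D.K)) × Fin (D.F.P D.K).d) × o) ι' Ω 𝒴)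
          (opA_mem_measOp_slotsOfRecord D ι c a s P 𝒵 dom Jc V mI L hbdA hmQA hmRA)
          (opB_mem_measOp_slotsOfRecord D ι c a s P 𝒵 dom Jc V mI L hbdB hmQB hmRB)).act Dt
      (ballClass (selfCtr (assemblyOn (restrict (readAtSlots (slotsOfRecord D ι c a s P 𝒵 dom Jc V mI L) ιbg) (measOp T ((Tor (unitMod (D.F.P D.K)) × Fin (D.F.P D.K).d) × o) ι' Ω 𝒴)
          (opA_mem_measOp_slotsOfRecord D ι c a s P 𝒵 dom Jc V mI L hbdA hmQA hmRA)
          (opB_mem_measOp_slotsOfRecord D ι c a s P 𝒵 dom Jc V mI L hbdB hmQB hmRB))).raw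
        (assemblyOn (restrict (readAtSlots (slotsOfRecord D ι c a s P 𝒵 dom Jc V mI L) ιbg) (measOp T ((Tor (unitMod (D.F.P D.K)) × Fin (D.F.P D.K).d) × o) ι' Ω 𝒴)
          (opA_mem_measOp_slotsOfRecord D ι c a s P 𝒵 dom Jc V mI L hbdA hmQA hmRA)
          (opB_mem_measOp_slotsOfRecord D ι c a s P 𝒵 dom Jc V mI L hbdB hmQB hmRB))).histRef) ROp RHist) W)
    (hE₀ : 0 ≤ E₀) (hcA : 0 ≤ cA) (hcB : 0 ≤ cB) (hc₁ : 0 ≤ c₁) (hr₀ : 0 < r₀) (hδ' : 0 ≤ δ')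
    (hθ0 : 0 < θ) (hθ1 : θ < 1) (hθθ' : θ ≤ θ') (hθ'1 : θ' ≤ 1) (hω : 0 < L.ins.ω) (hω1 : L.ins.ω < 1)
    (hh : cA * (EA₀ + E₀) < 1 - L.ins.ω)
    (hsmall : L.ins.ω + Φ' / (1 - 36 * Φ') * cA * (1 - L.ins.ω) / (1 - L.ins.ω - cA * (EA₀ + E₀)) < θ') :
    ∃ C₅, NE5 (B13StepOfRecord.outA (readAtSlots (slotsOfRecord D ι c a s P 𝒵 dom Jc V mI L) ιbg) E₀ cB)
      (B13StepOfRecord.outB (readAtSlots (slotsOfRecord D ι c a s P 𝒵 dom Jc V mI L) ιbg) E₀ cB) W κ θ' C₅ :=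
  exists_ne5_of_record_measOp_envelope_readAt (slotsOfRecord D ι c a s P 𝒵 dom Jc V mI L) ιbg E₀ cB hbdA
    (fun g U k Y b b' => hmQA (g (k - 1)) U.1 k Y b b') (fun g U k Y => hmRA (g (k - 1)) U.1 k Y) hbdB
    (fun g U k Y b b' => hmQB (g (k - 1)) U.1 k Y b b') (fun g U k Y => hmRB (g (k - 1)) U.1 k Y)
    (fun _ _ _ _ => measurable_const) (fun _ _ => measurable_const) hbB hbA hdA hdB hRA hRB hwer hfl hins hOp hHist hA hA0 hA0' hκ hdec hΦ0
    hΦsmall hΦ hact hexp hE₀ hcA hcB hc₁ hr₀ hδ' hθ0 hθ1 hθθ' hθ'1 hω hω1 hh hsmall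

end Summit.QuantumFields.BalabanUV.T4Continuum.B13StepEnvelopeEndSubstrate

end
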